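import Summits.Ventures.YMGap.RobustBall.TorusRange
import Summits.Ventures.YMGap.RobustBall.FineBall
import HarnessLib

/-!
# Venture YMGap, track ROBUST-BALL (Y2) — the one-link law of the perturbed torus specification in READS incidence
(rb-theory's optional upgrade ball `FineBall`): the fine re-weighting function and its loads

HONEST FRAMING. WHAT THIS IS: a venture file (cell `pub-ymgap`, track Y2 ROBUST-BALL, seat ds-2): the `g`-constancy
step that upgrades the landed (site-incidence) torus door to rb-theory's READS-INCIDENCE ball (`FineBall.lean`: `Reads`,
`polymersReading`, fine loads `oscLoadF / selfLipLoadF / crossLipF / crossLipLoadF`, balls `ClusterDomainFRFine /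
ClusterDomainFine`). A polymer through the site `e.1` that does NOT read the link `e` contributes a `g`-CONSTANT to the
landed re-weighting function `h_{W,e,η}(g) = localTilt W e η g` (`not_reads_iff`), and constants cancel in the tilted
one-link law; so the law is Haar tilted by `N Re tr(g B_η)` and re-weighted by the FINE re-weighting function
`h^F_{W,e,η}(g) = ∑_{X reads e} W_X(η^{e←g})` (`siteLaw_perturbedTorusSpec_thooft_fine`), whose oscillation / Lipschitz
constant / cross dependence are controlled by the FINE loads (`fineTilt_sub_le_oscLoadF`, `abs_fineTilt_sub_le_selfLipLoadF`,
`abs_fineTilt_sub_fineTilt_le_crossLipF` — in the cross leg a polymer reading `e` but not `y` drops out, again by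
`not_reads_iff`). WHAT THIS IS NOT: no door, no number (`TorusDoorFine`); finite-torus bookkeeping — no continuum claim.

## References
* p1 (g6) finding 2026-08-22T20:29Z / rb-theory rulings 20:34Z, 20:54Z (site vs reads incidence); the tree: `FineBall.lean`
  (rb-theory), `TorusOneLink.lean` / `TorusRange.lean` (this seat, landed ball). H. Föllmer, LNM 1362 (1988), Ch. I (2.20).
-/

noncomputable section

open MeasureTheory ProbabilityTheory Finset Function Real
open Literature.Probability.LatticeModels Literature.Probability.LatticeModels.DobrushinMetric
open Literature.MathematicalPhysics.QuantumLattice hiding torusNorm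
open Literature.MathematicalPhysics.QuantumFieldTheory hiding ZdEdge
open Literature.MathematicalPhysics.QuantumFieldTheory.Balaban1983to89.StrongCouplingTorusWindow

namespace Summit.Ventures.YMGap.RobustBall

variable {d L N : ℕ} [NeZero L]

section Fine

variable (W : Perturbation d L N) (β : ℝ)

/-- A polymer NOT in the reads-incidence index set of `e` does not see the link `e`: either it has no link at `e`
(`dependsOn'`) or it does not read `e` (`not_reads_iff`). [folklore] -/
theorem act_update_of_not_mem_polymersReading {X : Finset (Site d L)} (hX1 : X ∈ polymers (d := d) (L := L) 1)
    {e : Edge d L} (hX : X ∉ polymersReading W e) (ω : GaugeConfig d L (SUN N)) (g : SUN N) :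
    W.act X (update ω e g) = W.act X ω := by
  by_cases he : e.1 ∈ X
  · have hnr : ¬ Reads W X e := fun hr => hX (mem_polymersReading_iff.2 ⟨mem_polymersThroughEdge.2 ⟨hX1, he⟩, hr⟩)
    exact (not_reads_iff.1 hnr) ω g
  · exact act_update_of_not_mem W he ω g

/-- **The total perturbation splits at a link, reads incidence**: `W(ω^{e←g}) = (∑_{X does not read e} W_X(ω)) +
h^F_{W,e,ω}(g)` with the FINE re-weighting function `h^F(g) = ∑_{X reads e} W_X(ω^{e←g})`. [folklore] -/
theorem total_update_eq_fine (e : Edge d L) (ω : GaugeConfig d L (SUN N)) (g : SUN N) :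
    W.total (update ω e g) =
      (∑ X ∈ (polymers (d := d) (L := L) 1).filter (fun X => X ∉ polymersReading W e), W.act X ω) +
        ∑ X ∈ polymersReading W e, W.act X (update ω e g) := by
  classical
  unfold QuasiLocalGaugePerturbation.total
  rw [← Finset.sum_filter_add_sum_filter_not (polymers 1) (fun X : Finset (Site d L) => X ∉ polymersReading W e)]
  congr 1
  · exact Finset.sum_congr rfl fun X hX =>
      act_update_of_not_mem_polymersReading W (Finset.mem_filter.1 hX).1 (Finset.mem_filter.1 hX).2 ω g
  · refine Finset.sum_congr ?_ fun _ _ => rfl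
    ext X
    simp only [Finset.mem_filter, not_not, and_iff_right_iff_imp]
    exact fun h => (mem_polymersThroughEdge.1 (polymersReading_subset W e h)).1

/-- **U0 in reads incidence**: the one-link law of the member is the 't Hooft law `ν_{B_ω}` re-weighted by
`exp(−h^F_{W,e,ω})` with the FINE re-weighting function — the polymers that do not read `e` cancel in the
normalisation. [folklore] -/
theorem siteLaw_perturbedTorusSpec_thooft_fine (hL : 1 < L) (hN : 1 ≤ N) (e : Edge d L)
    (ω : GaugeConfig d L (SUN N)) :
    siteLaw (perturbedTorusSpec W β) e ω =
      ((haarProbability (SUN N)).tilted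
        fun g => (N : ℝ) * ((g : Matrix (Fin N) (Fin N) ℂ) * tField β e ω).trace.re).tilted
        fun g => -∑ X ∈ polymersReading W e, W.act X (update ω e g) := by
  classical
  rw [siteLaw_perturbedTorusSpec_eq_tilted_haar]
  set c₁ : ℝ := ∑ q ∈ (plaqsThrough e)ᶜ,
    Real.log (wilsonPlaqWeight N β (plaquetteHolonomy ω q.1 q.2.1.1 q.2.1.2)) with hc₁
  set c₂ : ℝ := -(β * N * (plaqsThrough e).card) with hc₂
  set c₃ : ℝ := ∑ X ∈ (polymers (d := d) (L := L) 1).filter (fun X => X ∉ polymersReading W e), W.act X ω with hc₃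
  set lin : SUN N → ℝ := fun g => (N : ℝ) * ((g : Matrix (Fin N) (Fin N) ℂ) * tField β e ω).trace.re
    with hlin
  have hsplit : (fun g : SUN N =>
      torusLogWeight (wilsonPlaqWeight N β) (update ω e g) - W.total (update ω e g)) =
      fun g => (c₁ + c₂ - c₃) + (lin g + -∑ X ∈ polymersReading W e, W.act X (update ω e g)) := by
    funext g
    rw [torusLogWeight_update_eq, localLogWeight_update_eq hL hN β e ω g, total_update_eq_fine]
    simp only [hlin]
    ring
  rw [hsplit, tilted_const_add_eq]
  obtain ⟨hm, hM⟩ := OneLinkTiltStability.su_linear_potential_measurable_bounded (N := N) (tField β e ω)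
  have hint : Integrable (fun g : SUN N => Real.exp (lin g)) (haarProbability (SUN N)) := by
    refine Integrable.of_bound (Real.measurable_exp.comp hm).aestronglyMeasurable
      (Real.exp ((N : ℝ) * (Real.sqrt N * frobNorm (tField β e ω)))) (Filter.Eventually.of_forall fun g => ?_)
    rw [Real.norm_eq_abs, abs_of_pos (Real.exp_pos _)]
    exact Real.exp_le_exp.2 (le_of_abs_le (hM g))
  rw [tilted_tilted hint]
  rfl

/-- The fine re-weighting function is measurable in the link variable. [folklore] -/
theorem measurable_fineTilt (e : Edge d L) (η : GaugeConfig d L (SUN N)) :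
    Measurable fun g : SUN N => ∑ X ∈ polymersReading W e, W.act X (update η e g) :=
  Finset.measurable_sum _ fun X _ => (W.measurable_act X).comp (measurable_update η)

/-- The fine re-weighting function is bounded, uniformly in the boundary condition. [folklore] -/
theorem exists_abs_fineTilt_le (e : Edge d L) :
    ∃ M, ∀ (η : GaugeConfig d L (SUN N)) (g : SUN N), |∑ X ∈ polymersReading W e, W.act X (update η e g)| ≤ M := by
  choose C hC using W.bounded'
  refine ⟨∑ X ∈ polymersReading W e, C X, fun η g => ?_⟩
  exact (Finset.abs_sum_le_sum_abs _ _).trans (Finset.sum_le_sum fun X _ => hC X _)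

variable {W}

/-- **Oscillation of the fine re-weighting function** `≤ a_F(e) = oscLoadF 0 e`. [folklore] -/
theorem fineTilt_sub_le_oscLoadF (w : LoadWitness W) (e : Edge d L) (η : GaugeConfig d L (SUN N)) (g g' : SUN N) :
    (∑ X ∈ polymersReading W e, W.act X (update η e g)) - ∑ X ∈ polymersReading W e, W.act X (update η e g') ≤
      w.oscLoadF 0 e := by
  unfold LoadWitness.oscLoadF
  rw [← Finset.sum_sub_distrib]
  refine Finset.sum_le_sum fun X _ => ?_
  rw [zero_mul, Real.exp_zero, one_mul]
  exact (le_abs_self _).trans ((w.osc_spec X).le e (update η e g) (update η e g') (update_eq_update_off η e g g'))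

/-- **Lipschitz constant of the fine re-weighting function** `≤ ℓ_{s,F}(e) = selfLipLoadF 0 e`. [folklore] -/
theorem abs_fineTilt_sub_le_selfLipLoadF (w : LoadWitness W) (e : Edge d L) (η : GaugeConfig d L (SUN N))
    (g g' : SUN N) :
    |(∑ X ∈ polymersReading W e, W.act X (update η e g)) - ∑ X ∈ polymersReading W e, W.act X (update η e g')| ≤
      w.selfLipLoadF 0 e * suFrobDist g g' := by
  unfold LoadWitness.selfLipLoadF
  rw [← Finset.sum_sub_distrib, Finset.sum_mul]
  refine (Finset.abs_sum_le_sum_abs _ _).trans (Finset.sum_le_sum fun X _ => ?_)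
  rw [zero_mul, Real.exp_zero, one_mul]
  have h := (w.lip_spec X).le e (update η e g) (update η e g') (update_eq_update_off η e g g')
  simpa using h

/-- **Cross dependence of the fine re-weighting function**: for `ω = η` off `y ≠ e`,
`|h^F_ω(g) − h^F_η(g)| ≤ ℓ_F(e,y) ‖ω_y − η_y‖_F` with `ℓ_F(e,y) = crossLipF 0 e y` — a polymer reading `e` but NOT `y`
drops out (`not_reads_iff`: `η^{e←g}` is `ω^{e←g}` changed at `y` alone). [folklore] -/
theorem abs_fineTilt_sub_fineTilt_le_crossLipF (w : LoadWitness W) {e y : Edge d L} (hye : y ≠ e)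
    {ω η : GaugeConfig d L (SUN N)} (hωη : ∀ z, z ≠ y → ω z = η z) (g : SUN N) :
    |(∑ X ∈ polymersReading W e, W.act X (update ω e g)) - ∑ X ∈ polymersReading W e, W.act X (update η e g)| ≤
      w.crossLipF 0 e y * suFrobDist (ω y) (η y) := by
  classical
  unfold LoadWitness.crossLipF
  rw [← Finset.sum_sub_distrib, Finset.sum_mul]
  have hupd : ∀ z, z ≠ y → update ω e g z = update η e g z := fun z hz => by
    by_cases hze : z = e
    · subst hze; simp
    · rw [update_of_ne hze, update_of_ne hze, hωη z hz]
  have hηω : update η e g = update (update ω e g) y (update η e g y) := by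
    funext z
    by_cases hz : z = y
    · subst hz; simp
    · rw [update_of_ne hz, hupd z hz]
  have hzero : ∀ X ∈ polymersReading W e, X ∉ (polymersReading W e).filter (fun X => Reads W X y) →
      W.act X (update ω e g) - W.act X (update η e g) = 0 := by
    intro X hX hXy
    have hy : ¬ Reads W X y := fun h => hXy (Finset.mem_filter.2 ⟨hX, h⟩)
    rw [sub_eq_zero, hηω, (not_reads_iff.1 hy)]
  rw [← Finset.sum_subset (Finset.filter_subset _ _) hzero]
  refine (Finset.abs_sum_le_sum_abs _ _).trans (Finset.sum_le_sum fun X _ => ?_)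
  rw [zero_mul, Real.exp_zero, one_mul]
  have h := (w.lip_spec X).le y (update ω e g) (update η e g) hupd
  rwa [update_of_ne hye, update_of_ne hye] at h

/-- Fine oscillation witnesses give nonnegative weighted fine oscillation loads. [folklore] -/
theorem oscLoadF_nonneg (w : LoadWitness W) (κ : ℝ) (e : Edge d L) : 0 ≤ w.oscLoadF κ e :=
  Finset.sum_nonneg fun X _ => mul_nonneg (Real.exp_pos _).le ((w.osc_spec X).nonneg e)

/-- Nonnegativity of the fine self-Lipschitz load. [folklore] -/
theorem selfLipLoadF_nonneg (w : LoadWitness W) (κ : ℝ) (e : Edge d L) : 0 ≤ w.selfLipLoadF κ e :=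
  Finset.sum_nonneg fun X _ => mul_nonneg (Real.exp_pos _).le ((w.lip_spec X).nonneg e)

/-- Nonnegativity of the fine cross coefficient. [folklore] -/
theorem crossLipF_nonneg (w : LoadWitness W) (κ : ℝ) (e y : Edge d L) : 0 ≤ w.crossLipF κ e y :=
  Finset.sum_nonneg fun X _ => mul_nonneg (Real.exp_pos _).le ((w.lip_spec X).nonneg y)

/-- Nonnegativity of the fine cross load. [folklore] -/
theorem crossLipLoadF_nonneg (w : LoadWitness W) (κ : ℝ) (e : Edge d L) : 0 ≤ w.crossLipLoadF κ e :=
  Finset.sum_nonneg fun y _ => crossLipF_nonneg w κ e y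

/-- `a_{F,0}(e) ≤ a_{F,κ}(e)` for `κ ≥ 0`. [folklore] -/
theorem oscLoadF_zero_le (w : LoadWitness W) {κ : ℝ} (hκ : 0 ≤ κ) (e : Edge d L) : w.oscLoadF 0 e ≤ w.oscLoadF κ e := by
  refine Finset.sum_le_sum fun X _ => mul_le_mul_of_nonneg_right ?_ ((w.osc_spec X).nonneg e)
  rw [zero_mul]
  exact Real.exp_le_exp.2 (mul_nonneg hκ (Nat.cast_nonneg _))

/-- `ℓ_{s,F,0}(e) ≤ ℓ_{s,F,κ}(e)` for `κ ≥ 0`. [folklore] -/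
theorem selfLipLoadF_zero_le (w : LoadWitness W) {κ : ℝ} (hκ : 0 ≤ κ) (e : Edge d L) :
    w.selfLipLoadF 0 e ≤ w.selfLipLoadF κ e := by
  refine Finset.sum_le_sum fun X _ => mul_le_mul_of_nonneg_right ?_ ((w.lip_spec X).nonneg e)
  rw [zero_mul]
  exact Real.exp_le_exp.2 (mul_nonneg hκ (Nat.cast_nonneg _))

end Fine

end Summit.Ventures.YMGap.RobustBall

end
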